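import Mathlib
import HarnessLib
import Summits.ValiantsHypothesis.ValiantsHypothesis.Theorems.LacunarySymmetroidMatrixDescartesProductPlusOneSixthOrderTower

/-!
# LINE (A) `product_plus_one` (crux `MatrixDescartes`, stmt-ValiantsHypothesis-18050, V1) — W-CB, brick E3b of the ORDER-6 ADDITIVE CERTIFICATE:
# ★★ THE LOCALISATION CELL — a window that meets NO fast ring carries at most SIX roots of `W(∏ f_j)` (binomial companies, ratio ≥ 3, any weights)

`K = 3`, support `d 0 < d 1 < d 2` with gap letters `d 1 = d 0 + e₁ + 1`, `d 2 = d 1 + e₂ + 1` and the RATIO HYPOTHESIS `2(e₁+1) ≤ e₂+1`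
(`2p ≤ s`, `p = e₁+1`, `s = e₂+1`, `q = p+s`; the floor's open core `(d2−d0)/(d1−d0) > 4` lies inside).  Window `(u,v)`, `0 < u`.  Every row
`f_j = Σ_l C (a j l) X^{d l}` is a BINOMIAL of the menu (`ψ₁ʲ(x) = rowPsi1 e₁ e₂ (a j 0) (−a j 1) (−a j 2) x`, ✓ `…CloudDefs`):
 (K01) slow knee `a j 2 = 0 ∧ 0 < a j 0·a j 1` — NO condition;  (P01) slow pole `a j 2 = 0 ∧ a j 0·a j 1 < 0 ∧ 0 ≤ f_j(u)f_j(v)`;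
 (K12) middle-rate knee `a j 0 = 0 ∧ 0 < a j 1·a j 2` whose RING MISSES THE WINDOW: `∀ x ∈ (u,v), 0 < c₀(s) + c₁(s)·ψ₁ʲ(x) + 5040·ψ₁ʲ(x)²`;
 (P12) pole `a j 0 = 0 ∧ a j 1·a j 2 < 0 ∧ 0 ≤ f_j(u)f_j(v)`;  (K02) fast knee `a j 1 = 0 ∧ 0 < a j 0·a j 2` whose ring misses the window
 (`0 < c₀(q) + c₁(q)·ψ₁ʲ(x) + 5040·ψ₁ʲ(x)²` on `(u,v)`);  (P02) pole `a j 1 = 0 ∧ a j 0·a j 2 < 0 ∧ 0 ≤ f_j(u)f_j(v)`;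
with `c₀(s) = 6(s−p)(2s−p)(2s+p)(3s+p)`, `c₁(s) = 240(3s+p)(2s−p)`, `c₀(q) = 6(12p⁴+56p³s+89p²s²+56ps³+12s⁴)`, `c₁(q) = 120(12p²+26ps+12s²)`.
THEN `W(∏_j f_j)` has NO strictly increasing chain of SEVEN roots in `(u,v)` (★★ `sixthOrder_ringfree_no_seven_zeros`), i.e. AT MOST SIX roots there
(★★ `sixthOrder_ringfree_wronskian_roots_le_six`).  Any number of slow knees, poles of all three rates, knees of the two fast rates anywhere whose rings
avoid the window, ANY multiplicities (repeated rows) — inside one window, the complement of the located hard case (a fast ring meeting the window).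

PROOF = the order-6 θ-shell ✓/⧗ `no_seven_zeros_of_sixth_order_law` (E2a) on the tower of E3a ✓/⧗ `…SixthOrderTower` (`S₀ = Σψ₁`, …, `S₆`), whose
order-6 value `S₆ − e₁S₄ + e₂S₂ − e₃S₀ = Σ_j Q_{r_j}(ψ₁ʲ)` is POSITIVE termwise (✓/⧗ `sixthOrder_row_facts`), and `W = −P²·S₀` on the window
(✓ `logWronskian_prod_eq_rowPsi1_sum`); the count form extracts a 7-chain with `Finset.orderEmbOfFin`.

HONEST FRAMING: ONE W-cell (helper).  With the window bookkeeping of ✓ `…GlobalCells` it yields `Z₊(W) ≤ 7·Z₊(P) + 6 + #{roots inside fast rings}`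
(memo `pub/val-lit/lmr/NOTE-p7g18-18050-LINEA-sixth-order-certificate.md` §3); the IN-RING count (memo (RING)/§6) is NOT proved, so nothing here proves
`WronskianBudgetK3` (EB2-W), `OneChangeFloorK3`, the stubs, `MatrixDescartes` (18050) or Conjecture B; `VP ≠ VNP` is NOT proved.  No definitions, no named
facts, no sorry; Mathlib + ✓ lane modules only.
-/

set_option linter.dupNamespace false

namespace Summit.ValiantsHypothesis.ValiantsHypothesis.Theorems.LacunarySymmetroidMatrixDescartes

namespace ProductPlusOne

open Finset Set Polynomial
open scoped BigOperators Topology Polynomial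

/-! ### §3 The localisation cell -/

/-- ★★ **THE LOCALISATION CELL (order six), chain form.**  Binomial company on `d 0 < d 1 < d 2` with `d 1 = d 0 + e₁ + 1`, `d 2 = d 1 + e₂ + 1` and
`2(e₁+1) ≤ e₂+1`; window `(u,v)`, `0 < u`; rows in the menu of the module docstring (slow knees free, poles with `0 ≤ f(u)f(v)`, middle/fast knees with
their ring off the window).  Then `W(∏_j f_j)` has no strictly increasing chain of seven zeros in `(u,v)`. [this file's theorem] -/
theorem sixthOrder_ringfree_no_seven_zeros {m : ℕ} (hm : 0 < m) (d : Fin 3 → ℕ) (e₁ e₂ : ℕ) (he₁ : d 1 = d 0 + e₁ + 1)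
    (he₂ : d 2 = d 1 + e₂ + 1) (h2p : 2 * (e₁ + 1) ≤ e₂ + 1) (a : Fin m → Fin 3 → ℝ) {u v : ℝ} (hu : 0 < u)
    (hrow : ∀ j,
      (a j 2 = 0 ∧ 0 < a j 0 * a j 1) ∨
      (a j 2 = 0 ∧ a j 0 * a j 1 < 0 ∧
          0 ≤ (∑ l, C (a j l) * X ^ (d l) : ℝ[X]).eval u * (∑ l, C (a j l) * X ^ (d l) : ℝ[X]).eval v) ∨
      (a j 0 = 0 ∧ 0 < a j 1 * a j 2 ∧ ∀ x ∈ Ioo u v,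
          0 < 6 * ((((e₂ : ℝ) + 1) - ((e₁ : ℝ) + 1)) * (2 * ((e₂ : ℝ) + 1) - ((e₁ : ℝ) + 1)) * (2 * ((e₂ : ℝ) + 1) + ((e₁ : ℝ) + 1))
                * (3 * ((e₂ : ℝ) + 1) + ((e₁ : ℝ) + 1)))
            + 240 * ((3 * ((e₂ : ℝ) + 1) + ((e₁ : ℝ) + 1)) * (2 * ((e₂ : ℝ) + 1) - ((e₁ : ℝ) + 1))) * rowPsi1 e₁ e₂ (a j 0) (-(a j 1)) (-(a j 2)) x
            + 5040 * rowPsi1 e₁ e₂ (a j 0) (-(a j 1)) (-(a j 2)) x ^ 2) ∨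
      (a j 0 = 0 ∧ a j 1 * a j 2 < 0 ∧
          0 ≤ (∑ l, C (a j l) * X ^ (d l) : ℝ[X]).eval u * (∑ l, C (a j l) * X ^ (d l) : ℝ[X]).eval v) ∨
      (a j 1 = 0 ∧ 0 < a j 0 * a j 2 ∧ ∀ x ∈ Ioo u v,
          0 < 6 * (12 * ((e₁ : ℝ) + 1) ^ 4 + 56 * ((e₁ : ℝ) + 1) ^ 3 * ((e₂ : ℝ) + 1) + 89 * ((e₁ : ℝ) + 1) ^ 2 * ((e₂ : ℝ) + 1) ^ 2
                + 56 * ((e₁ : ℝ) + 1) * ((e₂ : ℝ) + 1) ^ 3 + 12 * ((e₂ : ℝ) + 1) ^ 4)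
            + 120 * (12 * ((e₁ : ℝ) + 1) ^ 2 + 26 * ((e₁ : ℝ) + 1) * ((e₂ : ℝ) + 1) + 12 * ((e₂ : ℝ) + 1) ^ 2)
                * rowPsi1 e₁ e₂ (a j 0) (-(a j 1)) (-(a j 2)) x
            + 5040 * rowPsi1 e₁ e₂ (a j 0) (-(a j 1)) (-(a j 2)) x ^ 2) ∨
      (a j 1 = 0 ∧ a j 0 * a j 2 < 0 ∧
          0 ≤ (∑ l, C (a j l) * X ^ (d l) : ℝ[X]).eval u * (∑ l, C (a j l) * X ^ (d l) : ℝ[X]).eval v))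
    (x : Fin 7 → ℝ) (hx : StrictMono x) (hxI : ∀ i, x i ∈ Ioo u v)
    (hzero : ∀ i,
      ((∏ j, ∑ l, C (a j l) * X ^ (d l) : ℝ[X]) * (X * derivative (X * derivative (∏ j, ∑ l, C (a j l) * X ^ (d l) : ℝ[X])))
        - (X * derivative (∏ j, ∑ l, C (a j l) * X ^ (d l) : ℝ[X])) ^ 2).eval (x i) = 0) : False := by
  classical
  have hd := fin3_support_eq_gaps d e₁ e₂ he₁ he₂
  have hev : ∀ j x, (∑ l, C (a j l) * X ^ (d l) : ℝ[X]).eval x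
      = x ^ (d 0) * (a j 0 + a j 1 * x ^ (e₁ + 1) + a j 2 * x ^ (e₁ + e₂ + 2)) := by
    intro j x
    have h := (eval_trinomial_three (d 0) (e₁ + 1) (e₁ + e₂ + 2) (a j) x).1
    rw [hd] at h; rw [h]; ring
  have huv : u < v := (hxI 0).1.trans (hxI 0).2
  have hv : 0 < v := hu.trans huv
  -- the endpoint product of `f_j` controls the stripped row
  have hstrip : ∀ j, 0 ≤ (∑ l, C (a j l) * X ^ (d l) : ℝ[X]).eval u * (∑ l, C (a j l) * X ^ (d l) : ℝ[X]).eval v →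
      0 ≤ (a j 0 + a j 1 * u ^ (e₁ + 1) + a j 2 * u ^ (e₁ + e₂ + 2)) * (a j 0 + a j 1 * v ^ (e₁ + 1) + a j 2 * v ^ (e₁ + e₂ + 2)) := by
    intro j h
    rw [hev, hev] at h
    have hpow : 0 < u ^ (d 0) * v ^ (d 0) := mul_pos (pow_pos hu _) (pow_pos hv _)
    have : u ^ (d 0) * (a j 0 + a j 1 * u ^ (e₁ + 1) + a j 2 * u ^ (e₁ + e₂ + 2))
        * (v ^ (d 0) * (a j 0 + a j 1 * v ^ (e₁ + 1) + a j 2 * v ^ (e₁ + e₂ + 2)))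
        = (u ^ (d 0) * v ^ (d 0)) * ((a j 0 + a j 1 * u ^ (e₁ + 1) + a j 2 * u ^ (e₁ + e₂ + 2))
          * (a j 0 + a j 1 * v ^ (e₁ + 1) + a j 2 * v ^ (e₁ + e₂ + 2))) := by ring
    rw [this] at h
    exact (mul_nonneg_iff_of_pos_left hpow).1 h
  -- per-row facts
  have hfacts : ∀ j, _ := fun j => sixthOrder_row_facts e₁ e₂ h2p (a j) hu (by
    rcases hrow j with h | ⟨h2, hs, hend⟩ | h | ⟨h0, hs, hend⟩ | h | ⟨h1, hs, hend⟩
    · exact Or.inl h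
    · exact Or.inr (Or.inl ⟨h2, hs, hstrip j hend⟩)
    · exact Or.inr (Or.inr (Or.inl h))
    · exact Or.inr (Or.inr (Or.inr (Or.inl ⟨h0, hs, hstrip j hend⟩)))
    · exact Or.inr (Or.inr (Or.inr (Or.inr (Or.inl h))))
    · exact Or.inr (Or.inr (Or.inr (Or.inr (Or.inr ⟨h1, hs, hstrip j hend⟩)))))
  choose r hr using hfacts
  set p : ℝ := (e₁ : ℝ) + 1 with hp
  set s : ℝ := (e₂ : ℝ) + 1 with hs
  -- shorthand for the rows' tower values
  have hF : ∀ j, ∀ x ∈ Ioo u v, a j 0 - (-(a j 1)) * x ^ (e₁ + 1) - (-(a j 2)) * x ^ (e₁ + e₂ + 2) ≠ 0 :=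
    fun j x hx => ((hr j).2 x hx).1
  have hL3 : ∀ j, ∀ x ∈ Ioo u v, rowPsi3 e₁ e₂ (a j 0) (-(a j 1)) (-(a j 2)) x
      = r j ^ 2 * rowPsi1 e₁ e₂ (a j 0) (-(a j 1)) (-(a j 2)) x + 6 * rowPsi1 e₁ e₂ (a j 0) (-(a j 1)) (-(a j 2)) x ^ 2 :=
    fun j x hx => ((hr j).2 x hx).2.1
  have hL2 : ∀ j, ∀ x ∈ Ioo u v, rowPsi2 e₁ e₂ (a j 0) (-(a j 1)) (-(a j 2)) x ^ 2
      = r j ^ 2 * rowPsi1 e₁ e₂ (a j 0) (-(a j 1)) (-(a j 2)) x ^ 2 + 4 * rowPsi1 e₁ e₂ (a j 0) (-(a j 1)) (-(a j 2)) x ^ 3 :=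
    fun j x hx => ((hr j).2 x hx).2.2.1
  have hQ : ∀ j, ∀ x ∈ Ioo u v, 0 < 6 * (21 * r j ^ 4 - 5 * (p ^ 2 + s ^ 2 + (p + s) ^ 2) * r j ^ 2
        + (p ^ 2 * s ^ 2 + p ^ 2 * (p + s) ^ 2 + s ^ 2 * (p + s) ^ 2)) * rowPsi1 e₁ e₂ (a j 0) (-(a j 1)) (-(a j 2)) x ^ 2
      + 120 * (14 * r j ^ 2 - (p ^ 2 + s ^ 2 + (p + s) ^ 2)) * rowPsi1 e₁ e₂ (a j 0) (-(a j 1)) (-(a j 2)) x ^ 3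
      + 5040 * rowPsi1 e₁ e₂ (a j 0) (-(a j 1)) (-(a j 2)) x ^ 4 :=
    fun j x hx => ((hr j).2 x hx).2.2.2
  have hrate : ∀ j, r j = p ∨ r j = s ∨ r j = p + s := fun j => (hr j).1
  have hx0 : ∀ x ∈ Ioo u v, (x : ℝ) ≠ 0 := fun x hx => (hu.trans hx.1).ne'
  -- no row vanishes on the window
  have hf : ∀ x ∈ Ioo u v, ∀ j, (∑ l, C (a j l) * X ^ (d l) : ℝ[X]).eval x ≠ 0 := by
    intro x hx j
    rw [hev]
    have : a j 0 + a j 1 * x ^ (e₁ + 1) + a j 2 * x ^ (e₁ + e₂ + 2)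
        = a j 0 - (-(a j 1)) * x ^ (e₁ + 1) - (-(a j 2)) * x ^ (e₁ + e₂ + 2) := by ring
    rw [this]
    exact mul_ne_zero (pow_ne_zero _ (hx0 x hx)) (hF j x hx)
  -- the zeros of `W` in the window are zeros of `S₀ = Σψ₁`
  have hS0 : ∀ i, (∑ j, rowPsi1 e₁ e₂ (a j 0) (-(a j 1)) (-(a j 2)) (x i)) = 0 := by
    intro i
    have hxi := hxI i
    have hxpos : 0 < x i := hu.trans hxi.1
    have h := hzero i
    rw [logWronskian_prod_eq_rowPsi1_sum d e₁ e₂ he₁ he₂ a hxpos (hf (x i) hxi)] at h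
    have hP : ((∏ j, (∑ l, C (a j l) * X ^ (d l) : ℝ[X])).eval (x i)) ≠ 0 := by
      rw [eval_prod]; exact Finset.prod_ne_zero_iff.2 fun j _ => hf (x i) hxi j
    rcases mul_eq_zero.1 h with h1 | h1
    · exact absurd (neg_eq_zero.1 h1) (pow_ne_zero 2 hP)
    · exact h1
  -- the tower and its derivatives
  have h0 : ∀ x ∈ Ioo u v, HasDerivAt (fun t => ∑ j, rowPsi1 e₁ e₂ (a j 0) (-(a j 1)) (-(a j 2)) t)
      ((∑ j, rowPsi2 e₁ e₂ (a j 0) (-(a j 1)) (-(a j 2)) x) / x) x := by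
    intro x hx
    have h := HasDerivAt.fun_sum (u := Finset.univ)
      (fun j _ => hasDerivAt_rowPsi1 e₁ e₂ (a j 0) (-(a j 1)) (-(a j 2)) (hx0 x hx) (hF j x hx))
    simpa only [Finset.sum_div] using h
  have h1 : ∀ x ∈ Ioo u v, HasDerivAt (fun t => ∑ j, rowPsi2 e₁ e₂ (a j 0) (-(a j 1)) (-(a j 2)) t)
      ((∑ j, (r j ^ 2 * rowPsi1 e₁ e₂ (a j 0) (-(a j 1)) (-(a j 2)) x + 6 * rowPsi1 e₁ e₂ (a j 0) (-(a j 1)) (-(a j 2)) x ^ 2)) / x) x := by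
    intro x hx
    have h := HasDerivAt.fun_sum (u := Finset.univ)
      (fun j _ => hasDerivAt_rowPsi2 e₁ e₂ (a j 0) (-(a j 1)) (-(a j 2)) (hx0 x hx) (hF j x hx))
    refine (h.congr_deriv ?_)
    rw [Finset.sum_div]
    exact Finset.sum_congr rfl (fun j _ => by rw [hL3 j x hx])
  have h2 : ∀ x ∈ Ioo u v, HasDerivAt
      (fun t => ∑ j, (r j ^ 2 * rowPsi1 e₁ e₂ (a j 0) (-(a j 1)) (-(a j 2)) t + 6 * rowPsi1 e₁ e₂ (a j 0) (-(a j 1)) (-(a j 2)) t ^ 2))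
      ((∑ j, (r j ^ 2 + 12 * rowPsi1 e₁ e₂ (a j 0) (-(a j 1)) (-(a j 2)) x) * rowPsi2 e₁ e₂ (a j 0) (-(a j 1)) (-(a j 2)) x) / x) x := by
    intro x hx
    have h := HasDerivAt.fun_sum (u := Finset.univ)
      (fun j _ => hasDerivAt_tower2 e₁ e₂ (a j 0) (-(a j 1)) (-(a j 2)) (r j) (hx0 x hx) (hF j x hx))
    simpa only [Finset.sum_div] using h
  have h3 : ∀ x ∈ Ioo u v, HasDerivAt
      (fun t => ∑ j, (r j ^ 2 + 12 * rowPsi1 e₁ e₂ (a j 0) (-(a j 1)) (-(a j 2)) t) * rowPsi2 e₁ e₂ (a j 0) (-(a j 1)) (-(a j 2)) t)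
      ((∑ j, (r j ^ 4 * rowPsi1 e₁ e₂ (a j 0) (-(a j 1)) (-(a j 2)) x + 30 * r j ^ 2 * rowPsi1 e₁ e₂ (a j 0) (-(a j 1)) (-(a j 2)) x ^ 2
        + 120 * rowPsi1 e₁ e₂ (a j 0) (-(a j 1)) (-(a j 2)) x ^ 3)) / x) x := by
    intro x hx
    have h := HasDerivAt.fun_sum (u := Finset.univ)
      (fun j _ => hasDerivAt_tower3 e₁ e₂ (a j 0) (-(a j 1)) (-(a j 2)) (r j) (hx0 x hx) (hF j x hx) (hL2 j x hx) (hL3 j x hx))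
    simpa only [Finset.sum_div] using h
  have h4 : ∀ x ∈ Ioo u v, HasDerivAt
      (fun t => ∑ j, (r j ^ 4 * rowPsi1 e₁ e₂ (a j 0) (-(a j 1)) (-(a j 2)) t + 30 * r j ^ 2 * rowPsi1 e₁ e₂ (a j 0) (-(a j 1)) (-(a j 2)) t ^ 2
        + 120 * rowPsi1 e₁ e₂ (a j 0) (-(a j 1)) (-(a j 2)) t ^ 3))
      ((∑ j, (r j ^ 4 + 60 * r j ^ 2 * rowPsi1 e₁ e₂ (a j 0) (-(a j 1)) (-(a j 2)) x + 360 * rowPsi1 e₁ e₂ (a j 0) (-(a j 1)) (-(a j 2)) x ^ 2)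
        * rowPsi2 e₁ e₂ (a j 0) (-(a j 1)) (-(a j 2)) x) / x) x := by
    intro x hx
    have h := HasDerivAt.fun_sum (u := Finset.univ)
      (fun j _ => hasDerivAt_tower4 e₁ e₂ (a j 0) (-(a j 1)) (-(a j 2)) (r j) (hx0 x hx) (hF j x hx))
    simpa only [Finset.sum_div] using h
  have h5 : ∀ x ∈ Ioo u v, HasDerivAt
      (fun t => ∑ j, (r j ^ 4 + 60 * r j ^ 2 * rowPsi1 e₁ e₂ (a j 0) (-(a j 1)) (-(a j 2)) t + 360 * rowPsi1 e₁ e₂ (a j 0) (-(a j 1)) (-(a j 2)) t ^ 2)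
        * rowPsi2 e₁ e₂ (a j 0) (-(a j 1)) (-(a j 2)) t)
      ((∑ j, (r j ^ 6 * rowPsi1 e₁ e₂ (a j 0) (-(a j 1)) (-(a j 2)) x + 126 * r j ^ 4 * rowPsi1 e₁ e₂ (a j 0) (-(a j 1)) (-(a j 2)) x ^ 2
        + 1680 * r j ^ 2 * rowPsi1 e₁ e₂ (a j 0) (-(a j 1)) (-(a j 2)) x ^ 3 + 5040 * rowPsi1 e₁ e₂ (a j 0) (-(a j 1)) (-(a j 2)) x ^ 4)) / x) x := by
    intro x hx
    have h := HasDerivAt.fun_sum (u := Finset.univ)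
      (fun j _ => hasDerivAt_tower5 e₁ e₂ (a j 0) (-(a j 1)) (-(a j 2)) (r j) (hx0 x hx) (hF j x hx) (hL2 j x hx) (hL3 j x hx))
    simpa only [Finset.sum_div] using h
  -- the order-6 value is `Σ_j Q_{r_j}(ψ₁ʲ) > 0`
  have hq : ((e₁ + e₂ + 1 : ℕ) : ℝ) + 1 = p + s := by rw [hp, hs]; push_cast; ring
  refine no_seven_zeros_of_sixth_order_law e₁ e₂ (e₁ + e₂ + 1) hu.le h0 h1 h2 h3 h4 h5 ?_ x hx hxI hS0
  intro x hx
  rw [hq]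
  have hval : (∑ j, (r j ^ 6 * rowPsi1 e₁ e₂ (a j 0) (-(a j 1)) (-(a j 2)) x + 126 * r j ^ 4 * rowPsi1 e₁ e₂ (a j 0) (-(a j 1)) (-(a j 2)) x ^ 2
        + 1680 * r j ^ 2 * rowPsi1 e₁ e₂ (a j 0) (-(a j 1)) (-(a j 2)) x ^ 3 + 5040 * rowPsi1 e₁ e₂ (a j 0) (-(a j 1)) (-(a j 2)) x ^ 4))
      - (p ^ 2 + s ^ 2 + (p + s) ^ 2)
        * (∑ j, (r j ^ 4 * rowPsi1 e₁ e₂ (a j 0) (-(a j 1)) (-(a j 2)) x + 30 * r j ^ 2 * rowPsi1 e₁ e₂ (a j 0) (-(a j 1)) (-(a j 2)) x ^ 2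
          + 120 * rowPsi1 e₁ e₂ (a j 0) (-(a j 1)) (-(a j 2)) x ^ 3))
      + (p ^ 2 * s ^ 2 + p ^ 2 * (p + s) ^ 2 + s ^ 2 * (p + s) ^ 2)
        * (∑ j, (r j ^ 2 * rowPsi1 e₁ e₂ (a j 0) (-(a j 1)) (-(a j 2)) x + 6 * rowPsi1 e₁ e₂ (a j 0) (-(a j 1)) (-(a j 2)) x ^ 2))
      - p ^ 2 * s ^ 2 * (p + s) ^ 2 * (∑ j, rowPsi1 e₁ e₂ (a j 0) (-(a j 1)) (-(a j 2)) x)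
      = ∑ j, (6 * (21 * r j ^ 4 - 5 * (p ^ 2 + s ^ 2 + (p + s) ^ 2) * r j ^ 2
          + (p ^ 2 * s ^ 2 + p ^ 2 * (p + s) ^ 2 + s ^ 2 * (p + s) ^ 2)) * rowPsi1 e₁ e₂ (a j 0) (-(a j 1)) (-(a j 2)) x ^ 2
        + 120 * (14 * r j ^ 2 - (p ^ 2 + s ^ 2 + (p + s) ^ 2)) * rowPsi1 e₁ e₂ (a j 0) (-(a j 1)) (-(a j 2)) x ^ 3
        + 5040 * rowPsi1 e₁ e₂ (a j 0) (-(a j 1)) (-(a j 2)) x ^ 4) := by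
    rw [Finset.mul_sum, Finset.mul_sum, Finset.mul_sum, ← Finset.sum_sub_distrib, ← Finset.sum_add_distrib, ← Finset.sum_sub_distrib]
    refine Finset.sum_congr rfl (fun j _ => ?_)
    have h := sixthOrder_row_value p s (r j) (rowPsi1 e₁ e₂ (a j 0) (-(a j 1)) (-(a j 2)) x) (hrate j)
    linear_combination h
  have hpos : 0 < ∑ j, (6 * (21 * r j ^ 4 - 5 * (p ^ 2 + s ^ 2 + (p + s) ^ 2) * r j ^ 2
          + (p ^ 2 * s ^ 2 + p ^ 2 * (p + s) ^ 2 + s ^ 2 * (p + s) ^ 2)) * rowPsi1 e₁ e₂ (a j 0) (-(a j 1)) (-(a j 2)) x ^ 2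
        + 120 * (14 * r j ^ 2 - (p ^ 2 + s ^ 2 + (p + s) ^ 2)) * rowPsi1 e₁ e₂ (a j 0) (-(a j 1)) (-(a j 2)) x ^ 3
        + 5040 * rowPsi1 e₁ e₂ (a j 0) (-(a j 1)) (-(a j 2)) x ^ 4) :=
    Finset.sum_pos (fun j _ => hQ j x hx) ⟨⟨0, hm⟩, Finset.mem_univ _⟩
  rw [hp, hs] at hval hpos
  intro hzeroval
  rw [hval] at hzeroval
  exact absurd hzeroval hpos.ne'

/-- ★★ **THE LOCALISATION CELL, count form**: under the same hypotheses, `W(∏_j f_j)` has AT MOST SIX roots in `(u,v)`. [this file's theorem] -/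
theorem sixthOrder_ringfree_wronskian_roots_le_six {m : ℕ} (d : Fin 3 → ℕ) (e₁ e₂ : ℕ) (he₁ : d 1 = d 0 + e₁ + 1)
    (he₂ : d 2 = d 1 + e₂ + 1) (h2p : 2 * (e₁ + 1) ≤ e₂ + 1) (a : Fin m → Fin 3 → ℝ) {u v : ℝ} (hu : 0 < u)
    (hrow : ∀ j,
      (a j 2 = 0 ∧ 0 < a j 0 * a j 1) ∨
      (a j 2 = 0 ∧ a j 0 * a j 1 < 0 ∧
          0 ≤ (∑ l, C (a j l) * X ^ (d l) : ℝ[X]).eval u * (∑ l, C (a j l) * X ^ (d l) : ℝ[X]).eval v) ∨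
      (a j 0 = 0 ∧ 0 < a j 1 * a j 2 ∧ ∀ x ∈ Ioo u v,
          0 < 6 * ((((e₂ : ℝ) + 1) - ((e₁ : ℝ) + 1)) * (2 * ((e₂ : ℝ) + 1) - ((e₁ : ℝ) + 1)) * (2 * ((e₂ : ℝ) + 1) + ((e₁ : ℝ) + 1))
                * (3 * ((e₂ : ℝ) + 1) + ((e₁ : ℝ) + 1)))
            + 240 * ((3 * ((e₂ : ℝ) + 1) + ((e₁ : ℝ) + 1)) * (2 * ((e₂ : ℝ) + 1) - ((e₁ : ℝ) + 1))) * rowPsi1 e₁ e₂ (a j 0) (-(a j 1)) (-(a j 2)) x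
            + 5040 * rowPsi1 e₁ e₂ (a j 0) (-(a j 1)) (-(a j 2)) x ^ 2) ∨
      (a j 0 = 0 ∧ a j 1 * a j 2 < 0 ∧
          0 ≤ (∑ l, C (a j l) * X ^ (d l) : ℝ[X]).eval u * (∑ l, C (a j l) * X ^ (d l) : ℝ[X]).eval v) ∨
      (a j 1 = 0 ∧ 0 < a j 0 * a j 2 ∧ ∀ x ∈ Ioo u v,
          0 < 6 * (12 * ((e₁ : ℝ) + 1) ^ 4 + 56 * ((e₁ : ℝ) + 1) ^ 3 * ((e₂ : ℝ) + 1) + 89 * ((e₁ : ℝ) + 1) ^ 2 * ((e₂ : ℝ) + 1) ^ 2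
                + 56 * ((e₁ : ℝ) + 1) * ((e₂ : ℝ) + 1) ^ 3 + 12 * ((e₂ : ℝ) + 1) ^ 4)
            + 120 * (12 * ((e₁ : ℝ) + 1) ^ 2 + 26 * ((e₁ : ℝ) + 1) * ((e₂ : ℝ) + 1) + 12 * ((e₂ : ℝ) + 1) ^ 2)
                * rowPsi1 e₁ e₂ (a j 0) (-(a j 1)) (-(a j 2)) x
            + 5040 * rowPsi1 e₁ e₂ (a j 0) (-(a j 1)) (-(a j 2)) x ^ 2) ∨
      (a j 1 = 0 ∧ a j 0 * a j 2 < 0 ∧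
          0 ≤ (∑ l, C (a j l) * X ^ (d l) : ℝ[X]).eval u * (∑ l, C (a j l) * X ^ (d l) : ℝ[X]).eval v)) :
    (((∏ j, ∑ l, C (a j l) * X ^ (d l) : ℝ[X]) * (X * derivative (X * derivative (∏ j, ∑ l, C (a j l) * X ^ (d l) : ℝ[X])))
        - (X * derivative (∏ j, ∑ l, C (a j l) * X ^ (d l) : ℝ[X])) ^ 2).roots.toFinset.filter (fun t => u < t ∧ t < v)).card ≤ 6 := by
  classical
  set W : ℝ[X] := (∏ j, ∑ l, C (a j l) * X ^ (d l) : ℝ[X]) * (X * derivative (X * derivative (∏ j, ∑ l, C (a j l) * X ^ (d l) : ℝ[X])))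
      - (X * derivative (∏ j, ∑ l, C (a j l) * X ^ (d l) : ℝ[X])) ^ 2 with hWdef
  set T := W.roots.toFinset.filter (fun t => u < t ∧ t < v) with hT
  by_contra hgt
  push Not at hgt
  by_cases hW0 : W = 0
  · have : T = ∅ := by rw [hT, hW0, roots_zero, Multiset.toFinset_zero, Finset.filter_empty]
    rw [this, Finset.card_empty] at hgt; exact absurd hgt (by norm_num)
  have hm : 0 < m := by
    rcases Nat.eq_zero_or_pos m with h0 | hpos
    · subst h0
      exact absurd (by rw [hWdef]; simp) hW0
    · exact hpos
  obtain ⟨T', hT'T, hcard⟩ := Finset.exists_subset_card_eq (show 7 ≤ T.card by omega)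
  set x : Fin 7 → ℝ := fun i => T'.orderEmbOfFin hcard i with hxdef
  have hxmono : StrictMono x := fun i j hij => (T'.orderEmbOfFin hcard).strictMono hij
  have hxmem : ∀ i, x i ∈ T := fun i => hT'T (T'.orderEmbOfFin_mem hcard i)
  have hxI : ∀ i, x i ∈ Ioo u v := fun i => (Finset.mem_filter.1 (hxmem i)).2
  have hxz : ∀ i, W.eval (x i) = 0 := by
    intro i
    have h := (Finset.mem_filter.1 (hxmem i)).1
    rw [Multiset.mem_toFinset, mem_roots hW0] at h
    exact h
  exact sixthOrder_ringfree_no_seven_zeros hm d e₁ e₂ he₁ he₂ h2p a hu hrow x hxmono hxI hxz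

end ProductPlusOne

end Summit.ValiantsHypothesis.ValiantsHypothesis.Theorems.LacunarySymmetroidMatrixDescartes
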